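import Literature.Barriers.CriticalPhenomena.PlaquetteWalkHoleRootCutLawOver
import Literature.Barriers.CriticalPhenomena.PlaquetteWalkHoleRootCutDeadEnds
import HarnessLib

/-!
# Barrier catalogue (SAWScalingLimit): THE THIRD-SIDE LAW AND THE DEAD-END MARKING LAW FOR OVER-WALKS; `K_N1`'s dead-end kill

Leaf of `PlaquetteWalkHoleRootCutLawOver` (generic transport of cut data through the row mirror: `segment_cornerPt_reflect`,
`faces_not_mem_rowMirrorDom_iff`, `beyond_rowMirrorDom_of_beyond`; the over-route criterion and marking law) and
`PlaquetteWalkHoleRootCutDeadEnds` (the third-side law `ΩG.WE_eq_excursionWinding_of_under_twoLive_cut_deadSide` of its parent,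
and the marking law with per-walk UNCROSSED edges `ΩG.kindsIn_eq_corner_corner_of_twoCrossable_cut`).

§1 ★★★★★ `ΩG.WE_eq_excursionWinding_of_over_twoLive_cut_deadSide` — THE THIRD-SIDE LAW FOR OVER-WALKS: a cut from the upper corner
of the root edge with all edges dead but two sides of one rhombus `g ≠ farW`, a third side of `g` (not the root edge) dead ⇒ no wound
class-`B2a` over-walk.
§2 the marking law with per-walk uncrossed edges in WOUND form (under-walks; the uncrossedness hypothesis transports to the reversed
companion by `rev`'s `nth` formula) and ★★★★★ FOR OVER-WALKS (`ΩG.kindsIn_eq_corner_corner_of_twoCrossable_cut_over`,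
`…coCorner_coCorner…_over`; uncrossed edges reflect to uncrossed edges since `nth` commutes with the mirror).
§3 ★★★★★ `K_S2`'s dead-end kill in wound form with its marking (`kindsIn_farSW_eq_of_wound_under_swColumn_deadEnds`,
`not_W2FreeOff_farW_of_wound_under_swColumn_deadEnds`) and the NORTHERN TWIN: `K_N1 ∨ farNWN` absent, the far cell's column above
closed by dead OR DEAD-END cells up to a ceiling ⇒ every wound over-walk doubles `farNW` through two `θ`-corners
(`kindsIn_farNW_eq_of_wound_over_nwColumn_deadEnds`) — `w₁`-marked (`not_W1FreeOff_farW_of_wound_over_nwColumn_deadEnds`).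

Not in print; venture lane «pcv-sawmu», seat b-step0 gen 29 (FINDING-YB-KILL-FORCED-ZEROS §28).

References: A. Glazman, I. Manolescu, arXiv:1708.00395v3, §1 (Fig. 1, Fig. 2, remark after eq. (1)), §2.1, §4.2 (lattice symmetries),
Lemma 2.1 [GlazmanManolescu2019]; A. Glazman, Electron. Commun. Probab. 20 (2015) no. 86, Lemma 3.1, proof pp. 6–7 [Glazman2015WeightedSAW];
R. Courant, H. Robbins, *What is Mathematics?* (1941/1958), Ch. V Appendix §2 (the even–odd rule) [CourantRobbins1958].
-/

noncomputable section

open Set Function Complex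
open Literature.Topology.PlaneTopology

namespace Literature.Probability.RandomPlanarGeometry.SAW.YangBaxter

open Real
open Literature.Barriers.CriticalPhenomena.PlaquetteWalk (mirrorRow mirrorRowFace mirrorSide mirrorRow_side
  mirrorRowFace_mirrorRowFace mirrorRow_injective)

open private rev_snd_nth rev_snd_length from Literature.Probability.RandomPlanarGeometry.YangBaxterSAWGeneralDomain

namespace ΩG

variable {D : Set Face} {w : Face}

/-- The reflection in the root row on a cell, in coordinates. [cite: GlazmanManolescu2019, §4.2 (lattice symmetries)] -/
private theorem mirrorRowFace_mkOD (w : Face) (x y : ℤ) : mirrorRowFace w.2 ((x, y) : Face) = (x, 2 * w.2 - y) := by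
  simp [mirrorRowFace]

/-- The reflected side of a rhombus avoids the reflected side of another. [cite: GlazmanManolescu2019, §4.2 (lattice symmetries)] -/
private theorem mirror_side_ne {g f : Face} {t x : Side} (h : g.side t ≠ f.side x) :
    (mirrorRowFace w.2 g).side (mirrorSide t) ≠ (mirrorRowFace w.2 f).side (mirrorSide x) := by
  rw [← mirrorRow_side, ← mirrorRow_side]; exact fun h' => h (mirrorRow_injective _ h')

/-- The upper corner of the root edge reflects to the lower one. [cite: GlazmanManolescu2019, §4.2 (lattice symmetries)] -/
private theorem reflect_cHi {q : ℕ → ℤ × ℤ} (hq0 : q 0 = (w.1, w.2 + 1)) :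
    (((q 0).1, 2 * w.2 + 1 - (q 0).2) : ℤ × ℤ) = w := by
  rw [hq0]; exact Prod.ext rfl (by simp only; ring)

/-- A rhombus other than the far cell reflects to a rhombus other than the far cell. [cite: GlazmanManolescu2019, §4.2 (lattice symmetries)] -/
private theorem mirrorRowFace_ne_farWD {g : Face} (hg : g ≠ farW w) : mirrorRowFace w.2 g ≠ farW w := by
  intro e
  apply hg
  have e' := congrArg (mirrorRowFace w.2) e
  rwa [mirrorRowFace_mirrorRowFace, mirrorRowFace_farW] at e'

/-! ## §1 The third-side law for over-walks -/

/-- ★★★★★ **THE THIRD-SIDE LAW FOR OVER-WALKS.** Hole absent; a lattice cut `q 0 = (w.1, w.2 + 1), …, q K` (from the UPPER corner of the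
root edge) ending beyond the domain, its edges neither the hole's `W` side nor the root edge and all dead except the edges `i < k`,
which are sides `x`, `y` of one rhombus `g ≠ farW w`; a third side `z` of `g`, not the root edge, DEAD. Then no class-`B2a` OVER-walk
(first side `N`) is wound — the reflection of `WE_eq_excursionWinding_of_under_twoLive_cut_deadSide`.
[cite: GlazmanManolescu2019, Lemma 2.1 (statement, "in the form given in [Gl]"), §1 (Fig. 1), §4.2 (lattice symmetries)]
[cite: Glazman2015WeightedSAW, Lemma 3.1 (proof, pp. 6–7: a rhombus is visited at most twice)]
[cite: CourantRobbins1958, Ch. V Appendix §2 (the even–odd rule)] -/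
theorem WE_eq_excursionWinding_of_over_twoLive_cut_deadSide (hh : holeFaceW w ∉ D) {q : ℕ → ℤ × ℤ} {c : ℕ → Face}
    {s : ℕ → Side} {K : ℕ} (hq0 : q 0 = (w.1, w.2 + 1))
    (hseg : ∀ k, k < K → segment ℝ (toC (cornerPt (q k))) (toC (cornerPt (q (k + 1)))) = sideSeg (c k) (s k))
    (h1 : ∀ k, k < K → (c k).side (s k) ≠ (holeFaceW w).side .W) (h2 : ∀ k, k < K → (c k).side (s k) ≠ w.side .W)
    (hexit : (∀ f : Face, f ∈ D → f.1 < (q K).1) ∨ (∀ f : Face, f ∈ D → (q K).1 ≤ f.1) ∨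
      (∀ f : Face, f ∈ D → (q K).2 ≤ f.2) ∨ (∀ f : Face, f ∈ D → f.2 < (q K).2))
    {i k : ℕ} (hik : i < k)
    (hdead : ∀ k', k' < K → k' ≠ i → k' ≠ k →
      ((c k').side (s k')).faces.1 ∉ D ∨ ((c k').side (s k')).faces.2 ∉ D)
    {g : Face} (hg : g ≠ farW w) {x y : Side} (hci : (c i).side (s i) = g.side x) (hck : (c k).side (s k) = g.side y)
    {z : Side} (hz : g.side z ≠ w.side .W) (hzd : (g.side z).faces.1 ∉ D ∨ (g.side z).faces.2 ∉ D)
    (ω : ΩG D (w.side .W) (farW w)) (hr : RootedFace D (w.side .W) (farW w)) (h : ω.IsB2a)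
    (hN : ω.2.firstSideG = .N) (θ : ℝ) :
    ω.WE (fun _ => θ) = excursionWinding θ ω.2.firstSideG (ω.z1 hr h) ω.1 := by
  by_contra hW
  have hr' := rootedFace_rowMirrorDom w hr
  have h' := ω.mirrorFar_isB2a hr h
  have hh' : holeFaceW w ∉ rowMirrorDom w D := by rwa [mem_rowMirrorDom, mirrorRowFace_holeFaceW]
  have hS' : ω.mirrorFar.2.firstSideG = .S := by rw [mirrorFar_firstSideG, hN]; rfl
  have hzd' := (faces_not_mem_rowMirrorDom_iff w D (g.side z)).2 hzd
  rw [mirrorRow_side] at hzd'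
  refine absurd (WE_eq_excursionWinding_of_under_twoLive_cut_deadSide (D := rowMirrorDom w D) hh'
    (q := fun k => ((q k).1, 2 * w.2 + 1 - (q k).2)) (c := fun k => mirrorRowFace w.2 (c k))
    (s := fun k => mirrorSide (s k)) (K := K) (reflect_cHi hq0) (fun k hk => segment_cornerPt_reflect w (hseg k hk))
    (fun k hk => by have e := mirror_side_ne (w := w) (h1 k hk); rwa [mirrorRowFace_holeFaceW] at e)
    (fun k hk => by have e := mirror_side_ne (w := w) (h2 k hk); rwa [mirrorRowFace_self] at e)
    (beyond_rowMirrorDom_of_beyond w hexit) hik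
    (fun k' hk' hi hk => by
      have e := (faces_not_mem_rowMirrorDom_iff w D ((c k').side (s k'))).2 (hdead k' hk' hi hk)
      rwa [mirrorRow_side] at e)
    (mirrorRowFace_ne_farWD hg) (x := mirrorSide x) (y := mirrorSide y)
    (by show (mirrorRowFace w.2 (c i)).side (mirrorSide (s i)) = _; rw [← mirrorRow_side, hci, mirrorRow_side])
    (by show (mirrorRowFace w.2 (c k)).side (mirrorSide (s k)) = _; rw [← mirrorRow_side, hck, mirrorRow_side])
    (z := mirrorSide z) (by have e := mirror_side_ne (w := w) hz; rwa [mirrorRowFace_self] at e) hzd'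
    ω.mirrorFar hr' h' hS' (π - θ)) (ω.mirrorFar_wound hr h hW)

/-! ## §2 The marking law with per-walk uncrossed edges: wound form, and for over-walks -/

variable {ω : ΩG D (w.side .W) (farW w)}

/-- An edge uncrossed by a class-`B2a` walk is uncrossed by its reversed companion (same mid-edges, the excursion reversed).
[cite: GlazmanManolescu2019, §2.1 (walks and their reversals)] [cite: Glazman2015WeightedSAW, Lemma 3.1 (proof, pp. 6–7)] -/
theorem rev_nth_ne_of_nth_ne (hr : RootedFace D (w.side .W) (farW w)) (h : ω.IsB2a) {e : MidEdge}
    (hunc : ∀ n, 1 ≤ n → n ≤ ω.2.arcs.length → ω.2.nth n ≠ e) :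
    ∀ n, 1 ≤ n → n ≤ (ω.rev hr).2.arcs.length → (ω.rev hr).2.nth n ≠ e := by
  intro n hn1 hn
  rw [rev_snd_length ω hr h] at hn
  rw [rev_snd_nth ω hr h hn]
  split_ifs with hle
  · exact hunc n hn1 hn
  · exact hunc _ (by omega) (by omega)

/-- The reversed companion of a class-`B2a` walk has the same kinds off the far cell: a `[κ, κ]` list transports.
[cite: GlazmanManolescu2019, §2.1 (walks and their reversals)] [cite: Glazman2015WeightedSAW, Lemma 3.1 (proof, pp. 6–7)] -/
private theorem kindsIn_pair_of_rev_pairOD (ω : ΩG D (w.side .W) (farW w)) (hr : RootedFace D (w.side .W) (farW w))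
    (h : ω.IsB2a) {g : Face} (hg : g ≠ farW w) {κ : ArcKind} (hk : (ω.rev hr).2.kindsIn g = [κ, κ]) :
    ω.2.kindsIn g = [κ, κ] := by
  have hperm := ω.kindsIn_rev_perm hr h hg
  rw [hk] at hperm
  have hp : (ω.2.kindsIn g).Perm (List.replicate 2 κ) := hperm.symm
  exact List.perm_replicate.1 hp

/-- An edge uncrossed by a walk reflects to an edge uncrossed by the reflected walk. [cite: GlazmanManolescu2019, §4.2 (lattice symmetries)] -/
theorem mirrorFar_nth_ne_of_nth_ne (ω : ΩG D (w.side .W) (farW w)) {e : MidEdge}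
    (hunc : ∀ n, 1 ≤ n → n ≤ ω.2.arcs.length → ω.2.nth n ≠ e) :
    ∀ n, 1 ≤ n → n ≤ ω.mirrorFar.2.arcs.length → ω.mirrorFar.2.nth n ≠ mirrorRow w.2 e := by
  intro n hn1 hn e'
  rw [mirrorFar_length] at hn
  rw [YBWalk.nth_eq_of_mids_mirror ω.mirrorFar_mids] at e'
  exact hunc n hn1 hn (mirrorRow_injective _ e')

/-- ★★★★ **THE MARKING LAW with uncrossed edges, wound form (corner pairs)**: as `kindsIn_eq_corner_corner_of_twoCrossable_cut` with
the wound hypothesis `WE ≠ excursionWinding` in place of `AJ ≠ 0` (either orientation of the witness).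
[cite: GlazmanManolescu2019, §1 (Fig. 1, the remark after eq. (1)), Lemma 2.1]
[cite: Glazman2015WeightedSAW, Lemma 3.1 (proof, pp. 6–7)] [cite: CourantRobbins1958, Ch. V Appendix §2 (the even–odd rule)] -/
theorem kindsIn_eq_corner_corner_of_twoCrossable_cut_of_wound (hh : holeFaceW w ∉ D)
    (hr : RootedFace D (w.side .W) (farW w)) (h : ω.IsB2a) (hS : ω.2.firstSideG = .S) {q : ℕ → ℤ × ℤ} {c : ℕ → Face}
    {s : ℕ → Side} {K : ℕ} (hq0 : q 0 = w)
    (hseg : ∀ k, k < K → segment ℝ (toC (cornerPt (q k))) (toC (cornerPt (q (k + 1)))) = sideSeg (c k) (s k))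
    (h1 : ∀ k, k < K → (c k).side (s k) ≠ (holeFaceW w).side .W) (h2 : ∀ k, k < K → (c k).side (s k) ≠ w.side .W)
    (hexit : (∀ f : Face, f ∈ D → f.1 < (q K).1) ∨ (∀ f : Face, f ∈ D → (q K).1 ≤ f.1) ∨
      (∀ f : Face, f ∈ D → (q K).2 ≤ f.2) ∨ (∀ f : Face, f ∈ D → f.2 < (q K).2))
    {i k : ℕ} (hik : i < k)
    (hunc : ∀ k', k' < K → k' ≠ i → k' ≠ k → ∀ n, 1 ≤ n → n ≤ ω.2.arcs.length → ω.2.nth n ≠ (c k').side (s k'))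
    {g : Face} (hg : g ≠ farW w) {x y : Side}
    (hxy : (x = .N ∧ y = .E) ∨ (x = .E ∧ y = .N) ∨ (x = .S ∧ y = .W) ∨ (x = .W ∧ y = .S))
    (hci : (c i).side (s i) = g.side x) (hck : (c k).side (s k) = g.side y) {θ : ℝ}
    (hW : ω.WE (fun _ => θ) ≠ excursionWinding θ ω.2.firstSideG (ω.z1 hr h) ω.1) :
    ω.2.kindsIn g = [.corner, .corner] := by
  rcases ω.AJ_ne_zero_or_rev_of_wound hr h θ hW with hA | hA
  · exact kindsIn_eq_corner_corner_of_twoCrossable_cut hh hr h hS hq0 hseg h1 h2 hexit hik hunc hg hxy hci hck hA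
  · have h' := ω.rev_isB2a hr h
    have hS' : (ω.rev hr).2.firstSideG = .S := by rw [ω.rev_firstSide hr h]; exact hS
    exact kindsIn_pair_of_rev_pairOD ω hr h hg
      (kindsIn_eq_corner_corner_of_twoCrossable_cut hh hr h' hS' hq0 hseg h1 h2 hexit hik
        (fun k' hk' hi hk => rev_nth_ne_of_nth_ne hr h (hunc k' hk' hi hk)) hg hxy hci hck hA)

/-- ★★★★ **THE MARKING LAW with uncrossed edges, wound form (co-corner pairs)**: as `kindsIn_eq_coCorner_coCorner_of_twoCrossable_cut`
with the wound hypothesis in place of `AJ ≠ 0`. [cite: GlazmanManolescu2019, §1 (Fig. 2 («if θ = π/3, then w₂ = 0»)), Lemma 2.1]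
[cite: Glazman2015WeightedSAW, Lemma 3.1 (proof, pp. 6–7)] [cite: CourantRobbins1958, Ch. V Appendix §2 (the even–odd rule)] -/
theorem kindsIn_eq_coCorner_coCorner_of_twoCrossable_cut_of_wound (hh : holeFaceW w ∉ D)
    (hr : RootedFace D (w.side .W) (farW w)) (h : ω.IsB2a) (hS : ω.2.firstSideG = .S) {q : ℕ → ℤ × ℤ} {c : ℕ → Face}
    {s : ℕ → Side} {K : ℕ} (hq0 : q 0 = w)
    (hseg : ∀ k, k < K → segment ℝ (toC (cornerPt (q k))) (toC (cornerPt (q (k + 1)))) = sideSeg (c k) (s k))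
    (h1 : ∀ k, k < K → (c k).side (s k) ≠ (holeFaceW w).side .W) (h2 : ∀ k, k < K → (c k).side (s k) ≠ w.side .W)
    (hexit : (∀ f : Face, f ∈ D → f.1 < (q K).1) ∨ (∀ f : Face, f ∈ D → (q K).1 ≤ f.1) ∨
      (∀ f : Face, f ∈ D → (q K).2 ≤ f.2) ∨ (∀ f : Face, f ∈ D → f.2 < (q K).2))
    {i k : ℕ} (hik : i < k)
    (hunc : ∀ k', k' < K → k' ≠ i → k' ≠ k → ∀ n, 1 ≤ n → n ≤ ω.2.arcs.length → ω.2.nth n ≠ (c k').side (s k'))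
    {g : Face} (hg : g ≠ farW w) {x y : Side}
    (hxy : (x = .N ∧ y = .W) ∨ (x = .W ∧ y = .N) ∨ (x = .S ∧ y = .E) ∨ (x = .E ∧ y = .S))
    (hci : (c i).side (s i) = g.side x) (hck : (c k).side (s k) = g.side y) {θ : ℝ}
    (hW : ω.WE (fun _ => θ) ≠ excursionWinding θ ω.2.firstSideG (ω.z1 hr h) ω.1) :
    ω.2.kindsIn g = [.coCorner, .coCorner] := by
  rcases ω.AJ_ne_zero_or_rev_of_wound hr h θ hW with hA | hA
  · exact kindsIn_eq_coCorner_coCorner_of_twoCrossable_cut hh hr h hS hq0 hseg h1 h2 hexit hik hunc hg hxy hci hck hA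
  · have h' := ω.rev_isB2a hr h
    have hS' : (ω.rev hr).2.firstSideG = .S := by rw [ω.rev_firstSide hr h]; exact hS
    exact kindsIn_pair_of_rev_pairOD ω hr h hg
      (kindsIn_eq_coCorner_coCorner_of_twoCrossable_cut hh hr h' hS' hq0 hseg h1 h2 hexit hik
        (fun k' hk' hi hk => rev_nth_ne_of_nth_ne hr h (hunc k' hk' hi hk)) hg hxy hci hck hA)

/-- ★★★★★ **THE MARKING LAW WITH UNCROSSED EDGES FOR OVER-WALKS (corner pairs).** Hole absent; a cut `q 0 = (w.1, w.2 + 1), …, q K`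
ending beyond the domain, edges neither the hole's `W` side nor the root edge; every edge other than `i < k` UNCROSSED by the walk
(e.g. dead, or the door of a dead-end cell — `nth_ne_of_faces_not_mem`, `nth_ne_side_of_deadEnd`); the edges `i`, `k` a corner pair of
sides of one rhombus `g ≠ farW`. Then the wound class-`B2a` OVER-walk doubles `g` through two `θ`-corners.
[cite: GlazmanManolescu2019, §1 (Fig. 1, the remark after eq. (1)), §4.2 (lattice symmetries), Lemma 2.1]
[cite: Glazman2015WeightedSAW, Lemma 3.1 (proof, pp. 6–7)] [cite: CourantRobbins1958, Ch. V Appendix §2 (the even–odd rule)] -/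
theorem kindsIn_eq_corner_corner_of_twoCrossable_cut_over (hh : holeFaceW w ∉ D) (hr : RootedFace D (w.side .W) (farW w))
    (h : ω.IsB2a) (hN : ω.2.firstSideG = .N) {q : ℕ → ℤ × ℤ} {c : ℕ → Face} {s : ℕ → Side} {K : ℕ}
    (hq0 : q 0 = (w.1, w.2 + 1))
    (hseg : ∀ k, k < K → segment ℝ (toC (cornerPt (q k))) (toC (cornerPt (q (k + 1)))) = sideSeg (c k) (s k))
    (h1 : ∀ k, k < K → (c k).side (s k) ≠ (holeFaceW w).side .W) (h2 : ∀ k, k < K → (c k).side (s k) ≠ w.side .W)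
    (hexit : (∀ f : Face, f ∈ D → f.1 < (q K).1) ∨ (∀ f : Face, f ∈ D → (q K).1 ≤ f.1) ∨
      (∀ f : Face, f ∈ D → (q K).2 ≤ f.2) ∨ (∀ f : Face, f ∈ D → f.2 < (q K).2))
    {i k : ℕ} (hik : i < k)
    (hunc : ∀ k', k' < K → k' ≠ i → k' ≠ k → ∀ n, 1 ≤ n → n ≤ ω.2.arcs.length → ω.2.nth n ≠ (c k').side (s k'))
    {g : Face} (hg : g ≠ farW w) {x y : Side}
    (hxy : (x = .N ∧ y = .E) ∨ (x = .E ∧ y = .N) ∨ (x = .S ∧ y = .W) ∨ (x = .W ∧ y = .S))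
    (hci : (c i).side (s i) = g.side x) (hck : (c k).side (s k) = g.side y) {θ : ℝ}
    (hW : ω.WE (fun _ => θ) ≠ excursionWinding θ ω.2.firstSideG (ω.z1 hr h) ω.1) :
    ω.2.kindsIn g = [.corner, .corner] := by
  have hr' := rootedFace_rowMirrorDom w hr
  have h' := ω.mirrorFar_isB2a hr h
  have hh' : holeFaceW w ∉ rowMirrorDom w D := by rwa [mem_rowMirrorDom, mirrorRowFace_holeFaceW]
  have hS' : ω.mirrorFar.2.firstSideG = .S := by rw [mirrorFar_firstSideG, hN]; rfl
  have hxy' : (mirrorSide x = .N ∧ mirrorSide y = .W) ∨ (mirrorSide x = .W ∧ mirrorSide y = .N) ∨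
      (mirrorSide x = .S ∧ mirrorSide y = .E) ∨ (mirrorSide x = .E ∧ mirrorSide y = .S) := by
    rcases hxy with ⟨rfl, rfl⟩ | ⟨rfl, rfl⟩ | ⟨rfl, rfl⟩ | ⟨rfl, rfl⟩
    · exact Or.inr (Or.inr (Or.inl ⟨rfl, rfl⟩))
    · exact Or.inr (Or.inr (Or.inr ⟨rfl, rfl⟩))
    · exact Or.inl ⟨rfl, rfl⟩
    · exact Or.inr (Or.inl ⟨rfl, rfl⟩)
  have hk := kindsIn_eq_coCorner_coCorner_of_twoCrossable_cut_of_wound (D := rowMirrorDom w D) hh' hr' h' hS'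
    (q := fun k => ((q k).1, 2 * w.2 + 1 - (q k).2)) (c := fun k => mirrorRowFace w.2 (c k))
    (s := fun k => mirrorSide (s k)) (K := K) (reflect_cHi hq0) (fun k hk => segment_cornerPt_reflect w (hseg k hk))
    (fun k hk => by have e := mirror_side_ne (w := w) (h1 k hk); rwa [mirrorRowFace_holeFaceW] at e)
    (fun k hk => by have e := mirror_side_ne (w := w) (h2 k hk); rwa [mirrorRowFace_self] at e)
    (beyond_rowMirrorDom_of_beyond w hexit) hik
    (fun k' hk' hi hk => by
      have e := ω.mirrorFar_nth_ne_of_nth_ne (hunc k' hk' hi hk); rwa [mirrorRow_side] at e)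
    (mirrorRowFace_ne_farWD hg) hxy'
    (by show (mirrorRowFace w.2 (c i)).side (mirrorSide (s i)) = _; rw [← mirrorRow_side, hci, mirrorRow_side])
    (by show (mirrorRowFace w.2 (c k)).side (mirrorSide (s k)) = _; rw [← mirrorRow_side, hck, mirrorRow_side])
    (ω.mirrorFar_wound hr h hW)
  have hk2 := ω.kindsIn_eq_corner_of_mirrorFar_coCorner hk
  rwa [mirrorRowFace_mirrorRowFace] at hk2

/-- ★★★★★ **THE MARKING LAW WITH UNCROSSED EDGES FOR OVER-WALKS (co-corner pairs)**: as
`kindsIn_eq_corner_corner_of_twoCrossable_cut_over` with the two crossable edges a co-corner pair of sides of `g ≠ farW`: the wound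
over-walk doubles `g` through two `(π − θ)`-corners. [cite: GlazmanManolescu2019, §1 (Fig. 2), §4.2 (lattice symmetries), Lemma 2.1]
[cite: Glazman2015WeightedSAW, Lemma 3.1 (proof, pp. 6–7)] [cite: CourantRobbins1958, Ch. V Appendix §2 (the even–odd rule)] -/
theorem kindsIn_eq_coCorner_coCorner_of_twoCrossable_cut_over (hh : holeFaceW w ∉ D)
    (hr : RootedFace D (w.side .W) (farW w)) (h : ω.IsB2a) (hN : ω.2.firstSideG = .N) {q : ℕ → ℤ × ℤ} {c : ℕ → Face}
    {s : ℕ → Side} {K : ℕ} (hq0 : q 0 = (w.1, w.2 + 1))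
    (hseg : ∀ k, k < K → segment ℝ (toC (cornerPt (q k))) (toC (cornerPt (q (k + 1)))) = sideSeg (c k) (s k))
    (h1 : ∀ k, k < K → (c k).side (s k) ≠ (holeFaceW w).side .W) (h2 : ∀ k, k < K → (c k).side (s k) ≠ w.side .W)
    (hexit : (∀ f : Face, f ∈ D → f.1 < (q K).1) ∨ (∀ f : Face, f ∈ D → (q K).1 ≤ f.1) ∨
      (∀ f : Face, f ∈ D → (q K).2 ≤ f.2) ∨ (∀ f : Face, f ∈ D → f.2 < (q K).2))
    {i k : ℕ} (hik : i < k)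
    (hunc : ∀ k', k' < K → k' ≠ i → k' ≠ k → ∀ n, 1 ≤ n → n ≤ ω.2.arcs.length → ω.2.nth n ≠ (c k').side (s k'))
    {g : Face} (hg : g ≠ farW w) {x y : Side}
    (hxy : (x = .N ∧ y = .W) ∨ (x = .W ∧ y = .N) ∨ (x = .S ∧ y = .E) ∨ (x = .E ∧ y = .S))
    (hci : (c i).side (s i) = g.side x) (hck : (c k).side (s k) = g.side y) {θ : ℝ}
    (hW : ω.WE (fun _ => θ) ≠ excursionWinding θ ω.2.firstSideG (ω.z1 hr h) ω.1) :
    ω.2.kindsIn g = [.coCorner, .coCorner] := by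
  have hr' := rootedFace_rowMirrorDom w hr
  have h' := ω.mirrorFar_isB2a hr h
  have hh' : holeFaceW w ∉ rowMirrorDom w D := by rwa [mem_rowMirrorDom, mirrorRowFace_holeFaceW]
  have hS' : ω.mirrorFar.2.firstSideG = .S := by rw [mirrorFar_firstSideG, hN]; rfl
  have hxy' : (mirrorSide x = .N ∧ mirrorSide y = .E) ∨ (mirrorSide x = .E ∧ mirrorSide y = .N) ∨
      (mirrorSide x = .S ∧ mirrorSide y = .W) ∨ (mirrorSide x = .W ∧ mirrorSide y = .S) := by
    rcases hxy with ⟨rfl, rfl⟩ | ⟨rfl, rfl⟩ | ⟨rfl, rfl⟩ | ⟨rfl, rfl⟩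
    · exact Or.inr (Or.inr (Or.inl ⟨rfl, rfl⟩))
    · exact Or.inr (Or.inr (Or.inr ⟨rfl, rfl⟩))
    · exact Or.inl ⟨rfl, rfl⟩
    · exact Or.inr (Or.inl ⟨rfl, rfl⟩)
  have hk := kindsIn_eq_corner_corner_of_twoCrossable_cut_of_wound (D := rowMirrorDom w D) hh' hr' h' hS'
    (q := fun k => ((q k).1, 2 * w.2 + 1 - (q k).2)) (c := fun k => mirrorRowFace w.2 (c k))
    (s := fun k => mirrorSide (s k)) (K := K) (reflect_cHi hq0) (fun k hk => segment_cornerPt_reflect w (hseg k hk))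
    (fun k hk => by have e := mirror_side_ne (w := w) (h1 k hk); rwa [mirrorRowFace_holeFaceW] at e)
    (fun k hk => by have e := mirror_side_ne (w := w) (h2 k hk); rwa [mirrorRowFace_self] at e)
    (beyond_rowMirrorDom_of_beyond w hexit) hik
    (fun k' hk' hi hk => by
      have e := ω.mirrorFar_nth_ne_of_nth_ne (hunc k' hk' hi hk); rwa [mirrorRow_side] at e)
    (mirrorRowFace_ne_farWD hg) hxy'
    (by show (mirrorRowFace w.2 (c i)).side (mirrorSide (s i)) = _; rw [← mirrorRow_side, hci, mirrorRow_side])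
    (by show (mirrorRowFace w.2 (c k)).side (mirrorSide (s k)) = _; rw [← mirrorRow_side, hck, mirrorRow_side])
    (ω.mirrorFar_wound hr h hW)
  have hk2 := ω.kindsIn_eq_coCorner_of_mirrorFar_corner hk
  rwa [mirrorRowFace_mirrorRowFace] at hk2

/-! ## §3 `K_S2`'s dead-end kill in wound form, and its northern twin -/

/-- ★★★★★ **`K_S2`'S DEAD-END KILL, wound form.** Hole absent, `killSW ∉ D ∨ farSWS ∉ D`; the far cell's column below the kill row closed
by dead OR dead-end cells down to a floor `Y` (for every row `y` from `Y` to `w.2 − 3`: `(w.1 − 3, y)` or `(w.1 − 2, y)` absent, or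
`(w.1 − 3, y)` a dead end — its `W`, `N`, `S` neighbours absent). Then every WOUND class-`B2a` under-walk doubles `farSW` through two
`(π − θ)`-corners (either orientation). [cite: GlazmanManolescu2019, §1 (remark after eq. (1)), Lemma 2.1]
[cite: Glazman2015WeightedSAW, Lemma 3.1 (proof, pp. 6–7)] [cite: CourantRobbins1958, Ch. V Appendix §2 (the even–odd rule)] -/
theorem kindsIn_farSW_eq_of_wound_under_swColumn_deadEnds (hh : holeFaceW w ∉ D)
    (hKE : killSW w ∉ D ∨ ((w.1 - 2, w.2 - 2) : Face) ∉ D) {Y : ℤ} (hY : Y ≤ w.2 - 2)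
    (hcol : ∀ y : ℤ, Y ≤ y → y ≤ w.2 - 3 → ((w.1 - 3, y) : Face) ∉ D ∨ ((w.1 - 2, y) : Face) ∉ D ∨
      (((w.1 - 4, y) : Face) ∉ D ∧ ((w.1 - 3, y + 1) : Face) ∉ D ∧ ((w.1 - 3, y - 1) : Face) ∉ D))
    (hfloor : ∀ f : Face, f ∈ D → Y ≤ f.2)
    (ω : ΩG D (w.side .W) (farW w)) (hr : RootedFace D (w.side .W) (farW w)) (h : ω.IsB2a)
    (hS : ω.2.firstSideG = .S) {θ : ℝ}
    (hW : ω.WE (fun _ => θ) ≠ excursionWinding θ ω.2.firstSideG (ω.z1 hr h) ω.1) :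
    ω.2.kindsIn (farSW w) = [.coCorner, .coCorner] := by
  rcases ω.AJ_ne_zero_or_rev_of_wound hr h θ hW with hA | hA
  · exact kindsIn_farSW_eq_of_AJ_ne_zero_under_swColumn_deadEnds hh hKE hY hcol hfloor ω hr h hS hA
  · have h' := ω.rev_isB2a hr h
    have hS' : (ω.rev hr).2.firstSideG = .S := by rw [ω.rev_firstSide hr h]; exact hS
    exact kindsIn_pair_of_rev_pairOD ω hr h (farSW_ne_farW w)
      (kindsIn_farSW_eq_of_AJ_ne_zero_under_swColumn_deadEnds hh hKE hY hcol hfloor (ω.rev hr) hr h' hS' hA)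

/-- A doubled rhombus is visited. [cite: Glazman2015WeightedSAW, Lemma 3.1 (proof, pp. 6–7)] -/
private theorem mem_facesVisited_of_kindsIn_pairOD {g : Face} {κ : ArcKind} (hk : ω.2.kindsIn g = [κ, κ]) :
    g ∈ ω.2.facesVisited := by
  by_contra hn
  rw [YBWalk.kindsIn_eq_nil hn] at hk
  exact List.cons_ne_nil _ _ hk.symm

/-- ★★★★★ **`K_S2`'S DEAD-END KILL ⇒ every wound under-walk is `w₂`-MARKED** (`farSW` doubled through its `(π − θ)`-corners).
[cite: GlazmanManolescu2019, §1 (remark after eq. (1)), Lemma 2.1] [cite: Glazman2015WeightedSAW, Lemma 3.1 (proof, pp. 6–7)]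
[cite: CourantRobbins1958, Ch. V Appendix §2 (the even–odd rule)] -/
theorem not_W2FreeOff_farW_of_wound_under_swColumn_deadEnds (hh : holeFaceW w ∉ D)
    (hKE : killSW w ∉ D ∨ ((w.1 - 2, w.2 - 2) : Face) ∉ D) {Y : ℤ} (hY : Y ≤ w.2 - 2)
    (hcol : ∀ y : ℤ, Y ≤ y → y ≤ w.2 - 3 → ((w.1 - 3, y) : Face) ∉ D ∨ ((w.1 - 2, y) : Face) ∉ D ∨
      (((w.1 - 4, y) : Face) ∉ D ∧ ((w.1 - 3, y + 1) : Face) ∉ D ∧ ((w.1 - 3, y - 1) : Face) ∉ D))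
    (hfloor : ∀ f : Face, f ∈ D → Y ≤ f.2)
    (ω : ΩG D (w.side .W) (farW w)) (hr : RootedFace D (w.side .W) (farW w)) (h : ω.IsB2a)
    (hS : ω.2.firstSideG = .S) {θ : ℝ}
    (hW : ω.WE (fun _ => θ) ≠ excursionWinding θ ω.2.firstSideG (ω.z1 hr h) ω.1) : ¬ω.2.W2FreeOff (farW w) := by
  have hk := kindsIn_farSW_eq_of_wound_under_swColumn_deadEnds hh hKE hY hcol hfloor ω hr h hS hW
  exact fun hfree => hfree _ (mem_facesVisited_of_kindsIn_pairOD hk) (farSW_ne_farW w) hk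

/-- ★★★★★ **`K_N1`'S DEAD-END KILL (the northern twin).** Hole absent, `killNW ∉ D ∨ farNWN = (w.1 − 2, w.2 + 2) ∉ D`; the far cell's
column ABOVE the kill row closed by dead OR DEAD-END cells up to a ceiling `Y ≥ w.2 + 2` (for every row `y` from `w.2 + 3` to `Y`:
`(w.1 − 3, y)` or `(w.1 − 2, y)` absent, or `(w.1 − 3, y)` a dead end — its `W`, `S`, `N` neighbours absent), no face above `Y`. Then every
WOUND class-`B2a` OVER-walk (first side `N`) doubles `farNW` through two `θ`-corners: `kindsIn (farNW w) = [corner, corner]`.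
[cite: GlazmanManolescu2019, §1 (remark after eq. (1)), §4.2 (lattice symmetries), Lemma 2.1]
[cite: Glazman2015WeightedSAW, Lemma 3.1 (proof, pp. 6–7)] [cite: CourantRobbins1958, Ch. V Appendix §2 (the even–odd rule)] -/
theorem kindsIn_farNW_eq_of_wound_over_nwColumn_deadEnds (hh : holeFaceW w ∉ D)
    (hKE : killNW w ∉ D ∨ ((w.1 - 2, w.2 + 2) : Face) ∉ D) {Y : ℤ} (hY : w.2 + 2 ≤ Y)
    (hcol : ∀ y : ℤ, w.2 + 3 ≤ y → y ≤ Y → ((w.1 - 3, y) : Face) ∉ D ∨ ((w.1 - 2, y) : Face) ∉ D ∨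
      (((w.1 - 4, y) : Face) ∉ D ∧ ((w.1 - 3, y - 1) : Face) ∉ D ∧ ((w.1 - 3, y + 1) : Face) ∉ D))
    (hceil : ∀ f : Face, f ∈ D → f.2 ≤ Y)
    (ω : ΩG D (w.side .W) (farW w)) (hr : RootedFace D (w.side .W) (farW w)) (h : ω.IsB2a)
    (hN : ω.2.firstSideG = .N) {θ : ℝ}
    (hW : ω.WE (fun _ => θ) ≠ excursionWinding θ ω.2.firstSideG (ω.z1 hr h) ω.1) :
    ω.2.kindsIn (farNW w) = [.corner, .corner] := by
  have hr' := rootedFace_rowMirrorDom w hr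
  have h' := ω.mirrorFar_isB2a hr h
  have hh' : holeFaceW w ∉ rowMirrorDom w D := by rwa [mem_rowMirrorDom, mirrorRowFace_holeFaceW]
  have hS' : ω.mirrorFar.2.firstSideG = .S := by rw [mirrorFar_firstSideG, hN]; rfl
  have hKE' : killSW w ∉ rowMirrorDom w D ∨ ((w.1 - 2, w.2 - 2) : Face) ∉ rowMirrorDom w D := by
    rcases hKE with hk | hk
    · left; rwa [mem_rowMirrorDom, mirrorRowFace_killSW]
    · right; rw [mem_rowMirrorDom, mirrorRowFace_mkOD, show 2 * w.2 - (w.2 - 2) = w.2 + 2 by ring]; exact hk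
  have hcol' : ∀ y : ℤ, 2 * w.2 - Y ≤ y → y ≤ w.2 - 3 →
      ((w.1 - 3, y) : Face) ∉ rowMirrorDom w D ∨ ((w.1 - 2, y) : Face) ∉ rowMirrorDom w D ∨
        (((w.1 - 4, y) : Face) ∉ rowMirrorDom w D ∧ ((w.1 - 3, y + 1) : Face) ∉ rowMirrorDom w D ∧
          ((w.1 - 3, y - 1) : Face) ∉ rowMirrorDom w D) := by
    intro y hy1 hy2
    simp only [mem_rowMirrorDom, mirrorRowFace_mkOD]
    rw [show 2 * w.2 - (y + 1) = 2 * w.2 - y - 1 by ring, show 2 * w.2 - (y - 1) = 2 * w.2 - y + 1 by ring]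
    exact hcol (2 * w.2 - y) (by omega) (by omega)
  have hfloor' : ∀ f : Face, f ∈ rowMirrorDom w D → 2 * w.2 - Y ≤ f.2 := by
    intro f hf; rw [mem_rowMirrorDom] at hf; have := hceil _ hf; obtain ⟨x, y⟩ := f
    rw [mirrorRowFace_mkOD] at this; simp only at this ⊢; omega
  have hk := kindsIn_farSW_eq_of_wound_under_swColumn_deadEnds hh' hKE' (Y := 2 * w.2 - Y) (by omega) hcol' hfloor'
    ω.mirrorFar hr' h' hS' (ω.mirrorFar_wound hr h hW)
  have hk2 := ω.kindsIn_eq_corner_of_mirrorFar_coCorner hk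
  rwa [mirrorRowFace_farSW] at hk2

/-- ★★★★★ **`K_N1`'S DEAD-END KILL ⇒ every wound over-walk is `w₁`-MARKED** (`farNW` doubled through its `θ`-corners).
[cite: GlazmanManolescu2019, §1 (remark after eq. (1)), §4.2 (lattice symmetries), Lemma 2.1]
[cite: Glazman2015WeightedSAW, Lemma 3.1 (proof, pp. 6–7)] [cite: CourantRobbins1958, Ch. V Appendix §2 (the even–odd rule)] -/
theorem not_W1FreeOff_farW_of_wound_over_nwColumn_deadEnds (hh : holeFaceW w ∉ D)
    (hKE : killNW w ∉ D ∨ ((w.1 - 2, w.2 + 2) : Face) ∉ D) {Y : ℤ} (hY : w.2 + 2 ≤ Y)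
    (hcol : ∀ y : ℤ, w.2 + 3 ≤ y → y ≤ Y → ((w.1 - 3, y) : Face) ∉ D ∨ ((w.1 - 2, y) : Face) ∉ D ∨
      (((w.1 - 4, y) : Face) ∉ D ∧ ((w.1 - 3, y - 1) : Face) ∉ D ∧ ((w.1 - 3, y + 1) : Face) ∉ D))
    (hceil : ∀ f : Face, f ∈ D → f.2 ≤ Y)
    (ω : ΩG D (w.side .W) (farW w)) (hr : RootedFace D (w.side .W) (farW w)) (h : ω.IsB2a)
    (hN : ω.2.firstSideG = .N) {θ : ℝ}
    (hW : ω.WE (fun _ => θ) ≠ excursionWinding θ ω.2.firstSideG (ω.z1 hr h) ω.1) : ¬ω.2.W1FreeOff (farW w) := by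
  have hk := kindsIn_farNW_eq_of_wound_over_nwColumn_deadEnds hh hKE hY hcol hceil ω hr h hN hW
  exact fun hfree => hfree _ (mem_facesVisited_of_kindsIn_pairOD hk) (farNW_ne_farW w) hk

end ΩG

end Literature.Probability.RandomPlanarGeometry.SAW.YangBaxter
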